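import Summits.BirchSwinnertonDyer.BirchSwinnertonDyer.Theorems.ManinLocalTwoThreeDyadicTwistGoodCriterion
import Literature.NumberTheory.DiophantineGeometry.MinimalDiscriminantBaseChangeCongruence
import HarnessLib

/-!
# THE E-BLIND C2 DICTIONARY at `2`: «some dyadic twist `W ⊗ d`, `d ∈ {−1, 2, −2}`, is `2`-semistable» ⟺ «`ord₂ j ≤ 0` ∨ (`ord₂ j ≥ 12` ∧
# `ord₂ Δ_min ∈ {6, 12}`)», and the C2 CORE explicitly (route `ManinLocalTwoThree`, crux C2 `ManinOddAtFour` stmt-BirchSwinnertonDyer-22967;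
# cell bsd-f2-manin, p2 gen 16)

Sequel of `…DyadicTwistGoodCriterion` (THEOREMS A, A′, B-`j`), in the cell's currency (`f₂`, `ord₂ Δ_min` at the place of `ℤ` above `2`,
`|j|₂` at the place of `𝓞 ℚ` above `2`, twists `W.quadraticTwist (d : ℚ)`, `d : ℤ`).
* §5 bookkeeping: roots of valuations in `ℤₘ₀`; `|n|₂ ≤ 2⁻ᵏ ⟺ 2ᵏ ∣ n`; both places above `2` carry the same `f₂`, `ord₂ Δ_min`;
  `f₂ ≤ 1 ⟺ good ∨ multiplicative`, `f₂ = 0 ⟺ good` (Silverman ATAEC IV.10.2).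
* §6 ⟸: `ord₂ j ≥ 12 ∧ ord₂ Δ_min = 6 ⟹ f₂(W ⊗ ±2) = 0` (THEOREM A on a global minimal model: `c₄³ = jΔ`, `c₆² = c₄³ − 1728Δ`);
  `ord₂ j ≥ 12 ∧ ord₂ Δ_min = 12 ⟹ f₂(W ⊗ (−1)) = 0` (THEOREM A′); `ord₂ j ≤ 0`: p2 g14/g15's dyadic untwist.  ⟹ THEOREM B
  `valuation_j_ordMinimalDiscriminant_of_conductorExponent_dyadicTwist_le_one`: `f₂(W ⊗ d) ≤ 1` ⟹ `ord₂ j ≤ 0`, or `ord₂ j ≥ 12` with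
  `ord₂ Δ_min = 12` (`d = −1`) / `6` (`d = ±2`) — congruence `12 ∣ ord₂Δ_min(X) − ord₂Δ(X)` for `X = W, W ⊗ d`, Kraus's
  `¬(2⁸ ∣ c₄ ∧ 2¹⁶ ∣ Δ_min)`, and `f₂(W) ∈ {4, 6}` (Barrios Thm. 5.1 backwards).  DICTIONARY `exists_conductorExponent_dyadicTwist_le_one_iff_valuation_j`,
  CORE `forall_two_le_conductorExponent_dyadicTwist_iff_valuation_j`: for `W` additive at `2`, every dyadic twist is additive iff
  `0 < ord₂ j < 12` or (`ord₂ j ≥ 12` ∧ `ord₂ Δ_min ∉ {6, 12}`) — the open C2 laws of `Lines/kato_shift_two.lean` live on `v₂(N) ∈ {2,3,5,7,8}`,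
  the `16 ∥ N` rows `II/4, I₀*/8, I₂*/10, I₃*/11`, and at `64 ∥ N` on `I₀*/10, I₂*/12, I₄…₇*/14…17, II*/14` and `II/6 ∩ {ord₂ j ∈ {6, 9}}`
  (census N ≤ 5·10⁵, TWISTCENSUS2: core = 104 344 of the 167 088 classes with `64 ∥ N`).
HONEST FRAMING: local structure / bookkeeping by name; nothing about BSD, Manin's conjecture or C2 is proved; C2 OPEN on the core.
[cite: Kraus1989, Prop. 2] [cite: SilvermanAEC2009, VII.1.3, VII.5 Prop. 5.1, VIII.8.3, X.5 Cor. 5.4] [cite: SilvermanATAEC1994, IV.10.2]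
[cite: BarriosEtAl2025, Thm. 5.1 (arXiv:2501.03209 pp. 15–16)]
-/

set_option autoImplicit false
-- lint-debt: the directory name repeats the summit name (sibling precedent `ManinLocalTwoThreeDyadicCoreBinders.lean`)
set_option linter.dupNamespace false

noncomputable section

open scoped Classical NumberField
open WeierstrassCurve IsDedekindDomain IsDedekindDomain.HeightOneSpectrum Rat.HeightOneSpectrum WithZero
  Literature.NumberTheory.DiophantineGeometry Literature.NumberTheory.EllipticCurves
  Literature.NumberTheory.GaloisRepresentations

namespace Summit.BirchSwinnertonDyer.BirchSwinnertonDyer.Theorems.ManinLocalTwoThree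

variable {v : HeightOneSpectrum (𝓞 ℚ)}

/-! ## §5 Bookkeeping for the dictionary: roots of valuations, the two places above `2`, integer divisibility -/

/-- Cube roots of valuation bounds: `x³ ≤ ϖ^{3a}` ⟹ `x ≤ ϖ^{a}` in `ℤₘ₀`. [folklore] -/
theorem le_exp_of_pow_three_le_exp {x : WithZero (Multiplicative ℤ)} {a : ℤ} (h : x ^ 3 ≤ exp (3 * a)) : x ≤ exp a := by
  by_cases hx : x = 0
  · rw [hx]; exact zero_le
  · rw [← exp_log hx] at h ⊢
    rw [← exp_nsmul, exp_le_exp, nsmul_eq_mul, Nat.cast_ofNat] at h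
    exact exp_le_exp.mpr (by omega)

/-- Square roots of valuations: `x² = ϖ^{2a}` ⟹ `x = ϖ^{a}` in `ℤₘ₀`. [folklore] -/
theorem eq_exp_of_pow_two_eq_exp {x : WithZero (Multiplicative ℤ)} {a : ℤ} (h : x ^ 2 = exp (2 * a)) : x = exp a := by
  by_cases hx : x = 0
  · rw [hx, zero_pow two_ne_zero] at h; exact absurd h.symm exp_ne_zero
  · rw [← exp_log hx] at h ⊢
    rw [← exp_nsmul, exp_inj, nsmul_eq_mul, Nat.cast_ofNat] at h
    exact exp_inj.mpr (by omega)

/-- At `v ∋ 2`: `|n|_v ≤ 2^{-k}` for an integer `n` iff `2^k ∣ n`. [folklore] -/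
theorem valuation_intCast_le_exp_iff_two_pow_dvd (hv : (2 : 𝓞 ℚ) ∈ v.asIdeal) (n : ℤ) (k : ℕ) :
    v.valuation ℚ (n : ℚ) ≤ exp (-(k : ℤ)) ↔ (2 : ℤ) ^ k ∣ n := by
  rw [Rat.valuation_intCast, HeightOneSpectrum.intValuation_le_pow_iff_mem, Rat.asIdeal_eq_span_natGenerator,
    Ideal.span_singleton_pow, Ideal.mem_span_singleton, Rat.natGenerator_eq_two hv]
  rw [← map_dvd_iff Rat.ringOfIntegersEquiv, map_pow, map_natCast, map_intCast, Nat.cast_ofNat, Int.cast_id]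

/-! ### The two places above `2` (`ℤ` for `f₂`, `ord₂ Δ_min`; `𝓞 ℚ` for `|·|₂`), in the cell's currency -/

/-- `2 ∈ v₂` for the place `v₂ = primesEquiv⁻¹ 2` of `𝓞 ℚ`. [folklore] -/
theorem two_mem_asIdeal_placeTwo :
    (2 : 𝓞 ℚ) ∈ ((primesEquiv (R := 𝓞 ℚ)).symm ⟨2, Nat.prime_two⟩).asIdeal := by
  have hv : natGenerator ((primesEquiv (R := 𝓞 ℚ)).symm ⟨2, Nat.prime_two⟩) = 2 :=
    congrArg Subtype.val ((primesEquiv (R := 𝓞 ℚ)).apply_symm_apply ⟨2, Nat.prime_two⟩)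
  simpa using (Rat.natCast_mem_asIdeal_iff ((primesEquiv (R := 𝓞 ℚ)).symm ⟨2, Nat.prime_two⟩) (n := 2)).mpr (by simp [hv])

/-- `f₂` at the `ℤ`-place equals `f₂` at the `𝓞 ℚ`-place (both lie over the prime `2`). [folklore] -/
theorem conductorExponent_placeTwo_int_eq (X : WeierstrassCurve ℚ) [X.IsElliptic] :
    X.conductorExponent ((primesEquiv (R := ℤ)).symm ⟨2, Nat.prime_two⟩) =
      X.conductorExponent ((primesEquiv (R := 𝓞 ℚ)).symm ⟨2, Nat.prime_two⟩) :=
  conductorExponent_eq_of_primesEquiv_eq _ _ X (by rw [Equiv.apply_symm_apply, Equiv.apply_symm_apply])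

/-- `ord₂ Δ_min` at the `ℤ`-place equals `ord₂ Δ_min` at the `𝓞 ℚ`-place (both are computed in `ℚ₂`,
`ordMinimalDiscriminant_eq_padic`). [folklore] -/
theorem ordMinimalDiscriminant_placeTwo_int_eq (X : WeierstrassCurve ℚ) [X.IsElliptic] :
    X.ordMinimalDiscriminant ((primesEquiv (R := ℤ)).symm ⟨2, Nat.prime_two⟩) =
      X.ordMinimalDiscriminant ((primesEquiv (R := 𝓞 ℚ)).symm ⟨2, Nat.prime_two⟩) := by
  let e : Nat.Primes → ℕ := fun q =>
    haveI : Fact q.1.Prime := ⟨q.2⟩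
    (IsDiscreteValuationRing.addVal ℤ_[q] (((X.baseChange ℚ_[q]).minimal ℤ_[q]).integralModel ℤ_[q]).Δ).toNat
  have e1 : X.ordMinimalDiscriminant ((primesEquiv (R := ℤ)).symm ⟨2, Nat.prime_two⟩) =
      e (primesEquiv ((primesEquiv (R := ℤ)).symm ⟨2, Nat.prime_two⟩)) := X.ordMinimalDiscriminant_eq_padic _
  have e2 : X.ordMinimalDiscriminant ((primesEquiv (R := 𝓞 ℚ)).symm ⟨2, Nat.prime_two⟩) =
      e (primesEquiv ((primesEquiv (R := 𝓞 ℚ)).symm ⟨2, Nat.prime_two⟩)) := X.ordMinimalDiscriminant_eq_padic _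
  rw [e1, e2, Equiv.apply_symm_apply, Equiv.apply_symm_apply]

/-- `f₂ = 0` (at the `ℤ`-place) iff good reduction at the `𝓞 ℚ`-place above `2`. [cite: SilvermanATAEC1994, IV.10.2(a)] -/
theorem conductorExponent_placeTwo_eq_zero_iff (X : WeierstrassCurve ℚ) [X.IsElliptic] :
    X.conductorExponent ((primesEquiv (R := ℤ)).symm ⟨2, Nat.prime_two⟩) = 0 ↔
      X.HasGoodReductionAt ((primesEquiv (R := 𝓞 ℚ)).symm ⟨2, Nat.prime_two⟩) := by
  haveI : PerfectField (IsLocalRing.ResidueField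
      (((primesEquiv (R := 𝓞 ℚ)).symm ⟨2, Nat.prime_two⟩).adicCompletionIntegers ℚ)) := PerfectField.ofFinite
  rw [conductorExponent_placeTwo_int_eq]
  exact conductorExponent_eq_zero_iff_holds _ X

/-- `f₂ ≤ 1` (at the `ℤ`-place) iff good or multiplicative reduction at the `𝓞 ℚ`-place above `2`.
[cite: SilvermanATAEC1994, IV.10.2(a),(b)] -/
theorem conductorExponent_placeTwo_le_one_iff (X : WeierstrassCurve ℚ) [X.IsElliptic] :
    X.conductorExponent ((primesEquiv (R := ℤ)).symm ⟨2, Nat.prime_two⟩) ≤ 1 ↔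
      X.HasGoodReductionAt ((primesEquiv (R := 𝓞 ℚ)).symm ⟨2, Nat.prime_two⟩) ∨
        X.HasMultiplicativeReductionAt ((primesEquiv (R := 𝓞 ℚ)).symm ⟨2, Nat.prime_two⟩) := by
  haveI : PerfectField (IsLocalRing.ResidueField
      (((primesEquiv (R := 𝓞 ℚ)).symm ⟨2, Nat.prime_two⟩).adicCompletionIntegers ℚ)) := PerfectField.ofFinite
  rw [conductorExponent_placeTwo_int_eq, ← conductorExponent_eq_zero_iff_holds _ X, ← conductorExponent_eq_one_iff_holds _ X]
  omega

/-! ## §6 THE E-BLIND C2 DICTIONARY: «some dyadic twist is `2`-semistable» ⟺ «`ord₂ j ≤ 0` ∨ (`ord₂ j ≥ 12` ∧ `ord₂ Δ_min ∈ {6, 12}`)» -/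

/-- Transport of a good twist along `W₀ = C • W`: `(C • W) ⊗ d ≅ W ⊗ d` (`quadraticTwist_smul`). [cite: SilvermanAEC2009, X.5 Cor. 5.4] -/
theorem conductorExponent_quadraticTwist_placeTwo_eq_zero_of_smul (W : WeierstrassCurve ℚ) [W.IsElliptic] (C : VariableChange ℚ)
    {d : ℤ} (hd0 : d ≠ 0)
    (hgood : ((C • W).quadraticTwist (d : ℚ)).HasGoodReductionAt ((primesEquiv (R := 𝓞 ℚ)).symm ⟨2, Nat.prime_two⟩)) :
    (W.quadraticTwist (d : ℚ)).conductorExponent ((primesEquiv (R := ℤ)).symm ⟨2, Nat.prime_two⟩) = 0 := by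
  have hd0' : ((d : ℤ) : ℚ) ≠ 0 := by exact_mod_cast hd0
  haveI := W.isElliptic_quadraticTwist hd0'
  rw [conductorExponent_placeTwo_eq_zero_iff]
  rw [quadraticTwist_smul] at hgood
  exact (hasGoodReductionAt_smul_iff_holds _ _ _).mp hgood

/-- **⟸, supersingular branch at `ord₂ Δ_min = 6`.**  `ord₂ j(W) ≥ 12 ∧ ord₂ Δ_min(W) = 6` ⟹ `W ⊗ 2` or `W ⊗ (−2)` has GOOD reduction at
`2` (`f₂ = 0`): on a global minimal model `ord₂ c₄ ≥ 6` (`c₄³ = j Δ`) and `ord₂ c₆ = 6` (`c₆² = c₄³ − 1728 Δ`), THEOREM A.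
[cite: Kraus1989, Prop. 2] [cite: SilvermanAEC2009, VII.5 Prop. 5.1(a), VIII.8.3, X.5 Cor. 5.4] -/
theorem exists_conductorExponent_dyadicTwist_eq_zero_of_valuation_j_le_of_ordMinimalDiscriminant_eq_six
    (W : WeierstrassCurve ℚ) [W.IsElliptic]
    (hj : ((primesEquiv (R := 𝓞 ℚ)).symm ⟨2, Nat.prime_two⟩).valuation ℚ W.j ≤ exp (-12 : ℤ))
    (h6 : W.ordMinimalDiscriminant ((primesEquiv (R := ℤ)).symm ⟨2, Nat.prime_two⟩) = 6) :
    ∃ d : ℤ, (d = 2 ∨ d = -2) ∧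
      (W.quadraticTwist (d : ℚ)).conductorExponent ((primesEquiv (R := ℤ)).symm ⟨2, Nat.prime_two⟩) = 0 := by
  set v₂ : HeightOneSpectrum (𝓞 ℚ) := (primesEquiv (R := 𝓞 ℚ)).symm ⟨2, Nat.prime_two⟩ with hv₂def
  have hv : (2 : 𝓞 ℚ) ∈ v₂.asIdeal := two_mem_asIdeal_placeTwo
  obtain ⟨C, hC⟩ := WeierstrassCurve.hasGlobalMinimalModel_rat_holds W
  haveI := hC
  have hmin : (C • W).IsMinimalAt v₂ := IsGloballyMinimal.isMinimal v₂
  have hord : (C • W).ordMinimalDiscriminant v₂ = 6 := by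
    rw [ordMinimalDiscriminant_smul_holds v₂ W C, ← ordMinimalDiscriminant_placeTwo_int_eq W, h6]
  have hΔ : v₂.valuation ℚ (C • W).Δ = exp (-6 : ℤ) := by
    rw [valuation_Δ_eq_of_isMinimalAt_holds v₂ (C • W) hmin, hord]; rfl
  have hΔ0 : v₂.valuation ℚ (C • W).Δ ≠ 0 := by rw [hΔ]; exact exp_ne_zero
  have hjC : v₂.valuation ℚ (C • W).j ≤ exp (-12 : ℤ) := by rw [W.variableChange_j C]; exact hj
  have hc₄3 : v₂.valuation ℚ (C • W).c₄ ^ 3 = v₂.valuation ℚ (C • W).j * v₂.valuation ℚ (C • W).Δ := by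
    rw [valuation_j_eq_valuation_c₄_pow_div, div_mul_cancel₀ _ hΔ0]
  have hc₄ : v₂.valuation ℚ (C • W).c₄ ≤ exp (-6 : ℤ) := by
    refine le_exp_of_pow_three_le_exp ?_
    rw [hc₄3, hΔ]
    calc v₂.valuation ℚ (C • W).j * exp (-6 : ℤ) ≤ exp (-12 : ℤ) * exp (-6 : ℤ) := mul_le_mul' hjC le_rfl
      _ = exp (3 * (-6 : ℤ)) := by rw [← exp_add]; norm_num
  have h1728Δ : v₂.valuation ℚ (1728 * (C • W).Δ) = exp (-12 : ℤ) := by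
    rw [Valuation.map_mul, show (1728 : ℚ) = 2 ^ 6 * ((27 : ℤ) : ℚ) by norm_num, valuation_two_pow_mul_odd hv 6 (by decide), hΔ,
      ← exp_add]; norm_num
  have hlt : v₂.valuation ℚ ((C • W).c₄ ^ 3) < v₂.valuation ℚ (1728 * (C • W).Δ) := by
    rw [h1728Δ, Valuation.map_pow]
    calc v₂.valuation ℚ (C • W).c₄ ^ 3 ≤ exp (-6 : ℤ) ^ 3 := pow_le_pow_left' hc₄ 3
      _ < exp (-12 : ℤ) := by rw [← exp_nsmul, exp_lt_exp]; norm_num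
  have hc₆ : v₂.valuation ℚ (C • W).c₆ = exp (-6 : ℤ) := by
    have hrel : (C • W).c₆ ^ 2 = (C • W).c₄ ^ 3 - 1728 * (C • W).Δ := by linear_combination (C • W).c_relation
    refine eq_exp_of_pow_two_eq_exp ?_
    rw [← Valuation.map_pow, hrel, Valuation.map_sub_eq_of_lt_right _ hlt, h1728Δ]; norm_num
  obtain ⟨d, hd, hgood⟩ :=
    exists_hasGoodReductionAt_dyadicTwist_of_valuation_c₄_le_six_of_valuation_c₆_eq_six hv (C • W) hc₄ hc₆
  exact ⟨d, hd, conductorExponent_quadraticTwist_placeTwo_eq_zero_of_smul W C (by omega) hgood⟩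

/-- **⟸, supersingular branch at `ord₂ Δ_min = 12`.**  `ord₂ j(W) ≥ 12 ∧ ord₂ Δ_min(W) = 12` ⟹ the `χ₋₄`-twist `W ⊗ (−1)` has GOOD
reduction at `2` (`f₂ = 0`): on a global minimal model `ord₂ c₄ ≥ 8`, `ord₂ c₆ = 9`, and the model is not good at `2`; THEOREM A′.
[cite: Kraus1989, Prop. 2] [cite: SilvermanAEC2009, VII.5 Prop. 5.1(a), VIII.8.3, X.5 Cor. 5.4] -/
theorem conductorExponent_quadraticTwist_negOne_eq_zero_of_valuation_j_le_of_ordMinimalDiscriminant_eq_twelve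
    (W : WeierstrassCurve ℚ) [W.IsElliptic]
    (hj : ((primesEquiv (R := 𝓞 ℚ)).symm ⟨2, Nat.prime_two⟩).valuation ℚ W.j ≤ exp (-12 : ℤ))
    (h12 : W.ordMinimalDiscriminant ((primesEquiv (R := ℤ)).symm ⟨2, Nat.prime_two⟩) = 12) :
    (W.quadraticTwist ((-1 : ℤ) : ℚ)).conductorExponent ((primesEquiv (R := ℤ)).symm ⟨2, Nat.prime_two⟩) = 0 := by
  set v₂ : HeightOneSpectrum (𝓞 ℚ) := (primesEquiv (R := 𝓞 ℚ)).symm ⟨2, Nat.prime_two⟩ with hv₂def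
  have hv : (2 : 𝓞 ℚ) ∈ v₂.asIdeal := two_mem_asIdeal_placeTwo
  obtain ⟨C, hC⟩ := WeierstrassCurve.hasGlobalMinimalModel_rat_holds W
  haveI := hC
  have hmin : (C • W).IsMinimalAt v₂ := IsGloballyMinimal.isMinimal v₂
  have hord : (C • W).ordMinimalDiscriminant v₂ = 12 := by
    rw [ordMinimalDiscriminant_smul_holds v₂ W C, ← ordMinimalDiscriminant_placeTwo_int_eq W, h12]
  have hΔ : v₂.valuation ℚ (C • W).Δ = exp (-12 : ℤ) := by
    rw [valuation_Δ_eq_of_isMinimalAt_holds v₂ (C • W) hmin, hord]; rfl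
  have hΔ0 : v₂.valuation ℚ (C • W).Δ ≠ 0 := by rw [hΔ]; exact exp_ne_zero
  have hjC : v₂.valuation ℚ (C • W).j ≤ exp (-12 : ℤ) := by rw [W.variableChange_j C]; exact hj
  have hc₄3 : v₂.valuation ℚ (C • W).c₄ ^ 3 = v₂.valuation ℚ (C • W).j * v₂.valuation ℚ (C • W).Δ := by
    rw [valuation_j_eq_valuation_c₄_pow_div, div_mul_cancel₀ _ hΔ0]
  have hc₄ : v₂.valuation ℚ (C • W).c₄ ≤ exp (-8 : ℤ) := by
    refine le_exp_of_pow_three_le_exp ?_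
    rw [hc₄3, hΔ]
    calc v₂.valuation ℚ (C • W).j * exp (-12 : ℤ) ≤ exp (-12 : ℤ) * exp (-12 : ℤ) := mul_le_mul' hjC le_rfl
      _ = exp (3 * (-8 : ℤ)) := by rw [← exp_add]; norm_num
  have h1728Δ : v₂.valuation ℚ (1728 * (C • W).Δ) = exp (-18 : ℤ) := by
    rw [Valuation.map_mul, show (1728 : ℚ) = 2 ^ 6 * ((27 : ℤ) : ℚ) by norm_num, valuation_two_pow_mul_odd hv 6 (by decide), hΔ,
      ← exp_add]; norm_num
  have hlt : v₂.valuation ℚ ((C • W).c₄ ^ 3) < v₂.valuation ℚ (1728 * (C • W).Δ) := by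
    rw [h1728Δ, Valuation.map_pow]
    calc v₂.valuation ℚ (C • W).c₄ ^ 3 ≤ exp (-8 : ℤ) ^ 3 := pow_le_pow_left' hc₄ 3
      _ < exp (-18 : ℤ) := by rw [← exp_nsmul, exp_lt_exp]; norm_num
  have hc₆ : v₂.valuation ℚ (C • W).c₆ = exp (-9 : ℤ) := by
    have hrel : (C • W).c₆ ^ 2 = (C • W).c₄ ^ 3 - 1728 * (C • W).Δ := by linear_combination (C • W).c_relation
    refine eq_exp_of_pow_two_eq_exp ?_
    rw [← Valuation.map_pow, hrel, Valuation.map_sub_eq_of_lt_right _ hlt, h1728Δ]; norm_num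
  have hnotgood : ¬ (C • W).HasGoodReductionAt v₂ := by
    intro hg
    have h0 := ((ordMinimalDiscriminant_eq_zero_iff_holds v₂ (C • W)).mpr hg)
    omega
  have hgood := hasGoodReductionAt_quadraticTwist_negOne_of_valuation_c₄_le_eight_of_valuation_c₆_eq_nine hv (C • W)
    hnotgood hc₄ hc₆
  exact conductorExponent_quadraticTwist_placeTwo_eq_zero_of_smul W C (by decide) hgood

/-- **THEOREM B (E-blind, by name).**  If a dyadic twist `W ⊗ d`, `d ∈ {−1, 2, −2}`, is SEMISTABLE at `2` (`f₂(W ⊗ d) ≤ 1`) then either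
`ord₂ j(W) ≤ 0` (the twist is multiplicative or good ordinary), or `ord₂ j(W) ≥ 12` AND `ord₂ Δ_min(W) = 12` (`d = −1`) resp. `= 6`
(`d = ±2`) (the twist is good supersingular).  The `Δ_min` half: `12 ∣ ord₂Δ_min(X) − ord₂Δ(X)` for every model `X` of a curve
(applied to `W` and to `W ⊗ d`, `Δ(W ⊗ d) = d⁶Δ(W)`) gives `ord₂ Δ_min(W) ≡ 6·ord₂ d (mod 12)`; Kraus's `2⁸ ∣ c₄ ∧ 2¹⁶ ∣ Δ_min ⟹ not minimal`
caps `ord₂ Δ_min(W) < 16` when `ord₂ j ≥ 12`; and `W` is not good at `2` (`f₂(W) = 4` resp. `6`, Barrios Thm. 5.1).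
[cite: BarriosEtAl2025, Thm. 5.1 (arXiv:2501.03209 pp. 15–16)] [cite: Kraus1989, Prop. 2] [cite: SilvermanAEC2009, VII.1.3, VII.5 Prop. 5.1, X.5 Cor. 5.4] -/
theorem valuation_j_ordMinimalDiscriminant_of_conductorExponent_dyadicTwist_le_one (W : WeierstrassCurve ℚ) [W.IsElliptic]
    {d : ℤ} (hd : d = -1 ∨ d = 2 ∨ d = -2)
    (hle : (W.quadraticTwist (d : ℚ)).conductorExponent ((primesEquiv (R := ℤ)).symm ⟨2, Nat.prime_two⟩) ≤ 1) :
    1 ≤ ((primesEquiv (R := 𝓞 ℚ)).symm ⟨2, Nat.prime_two⟩).valuation ℚ W.j ∨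
      (((primesEquiv (R := 𝓞 ℚ)).symm ⟨2, Nat.prime_two⟩).valuation ℚ W.j ≤ exp (-12 : ℤ) ∧
        (d = -1 → W.ordMinimalDiscriminant ((primesEquiv (R := ℤ)).symm ⟨2, Nat.prime_two⟩) = 12) ∧
        (d = 2 ∨ d = -2 → W.ordMinimalDiscriminant ((primesEquiv (R := ℤ)).symm ⟨2, Nat.prime_two⟩) = 6)) := by
  set vZ : HeightOneSpectrum ℤ := (primesEquiv (R := ℤ)).symm ⟨2, Nat.prime_two⟩ with hvZdef
  set v₂ : HeightOneSpectrum (𝓞 ℚ) := (primesEquiv (R := 𝓞 ℚ)).symm ⟨2, Nat.prime_two⟩ with hv₂def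
  have hvZ : natGenerator vZ = 2 := congrArg Subtype.val ((primesEquiv (R := ℤ)).apply_symm_apply ⟨2, Nat.prime_two⟩)
  have hv : (2 : 𝓞 ℚ) ∈ v₂.asIdeal := two_mem_asIdeal_placeTwo
  haveI : PerfectField (IsLocalRing.ResidueField (vZ.adicCompletionIntegers ℚ)) := PerfectField.ofFinite
  have hd0 : d ≠ 0 := by omega
  have hd0' : ((d : ℤ) : ℚ) ≠ 0 := by exact_mod_cast hd0
  haveI := W.isElliptic_quadraticTwist hd0'
  have hss := (conductorExponent_placeTwo_le_one_iff (W.quadraticTwist (d : ℚ))).mp hle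
  rcases one_le_valuation_j_or_le_of_semistable_quadraticTwist hv W hd0' hss with h | hj
  · exact Or.inl h
  right
  -- the twist is GOOD (a multiplicative twist has `|j| > 1`)
  have hgood : (W.quadraticTwist (d : ℚ)).HasGoodReductionAt v₂ := by
    rcases hss with h | h
    · exact h
    · exfalso
      have h1 := one_lt_valuation_j_of_hasMultiplicativeReductionAt_rat (v := v₂) _ h
      rw [W.j_quadraticTwist hd0'] at h1
      have h2 : (1 : WithZero (Multiplicative ℤ)) < exp (-12 : ℤ) := lt_of_lt_of_le h1 hj
      rw [← exp_zero, exp_lt_exp] at h2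
      omega
  -- `W` itself is not good at `2` (Barrios: `f₂(W) = 4` resp. `6`)
  have hW0 : W.ordMinimalDiscriminant vZ ≠ 0 := by
    have key := conductorExponent_eq_of_conductorExponent_dyadicTwist_le_one vZ hvZ W hd hle
    have hf : W.conductorExponent vZ ≠ 0 := by
      rcases hd with h | h
      · rw [key.1 h]; decide
      · rw [key.2 h]; decide
    exact (conductorExponent_ne_zero_iff_ordMinimalDiscriminant_ne_zero vZ W).mp hf
  -- the congruence `ord₂ Δ_min(W) ≡ 6 ord₂ d (mod 12)`
  have hΔ0 : v₂.valuation ℚ W.Δ ≠ 0 := (Valuation.ne_zero_iff _).mpr W.isUnit_Δ.ne_zero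
  have hvd : v₂.valuation ℚ (d : ℚ) = if d = -1 then 1 else exp (-1 : ℤ) := by
    rcases hd with rfl | rfl | rfl
    · rw [if_pos rfl, show ((-1 : ℤ) : ℚ) = -1 by norm_num, Valuation.map_neg, Valuation.map_one]
    · rw [if_neg (by decide)]; simpa using Rat.valuation_two_of_two_mem hv
    · rw [if_neg (by decide), show ((-2 : ℤ) : ℚ) = -2 by norm_num, Valuation.map_neg]; exact Rat.valuation_two_of_two_mem hv
  have hvd0 : v₂.valuation ℚ (d : ℚ) ≠ 0 := by
    rw [hvd]
    split_ifs
    · exact one_ne_zero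
    · exact exp_ne_zero
  have h12W := W.twelve_dvd_ordMinimalDiscriminant_add_log_valuation_Δ v₂
  have h12X := (W.quadraticTwist (d : ℚ)).twelve_dvd_ordMinimalDiscriminant_add_log_valuation_Δ v₂
  have hX0 : (W.quadraticTwist (d : ℚ)).ordMinimalDiscriminant v₂ = 0 := (ordMinimalDiscriminant_eq_zero_iff_holds v₂ _).mpr hgood
  rw [hX0, quadraticTwist_Δ, Nat.cast_zero, zero_add, Valuation.map_mul, Valuation.map_pow,
    WithZero.log_mul (pow_ne_zero 6 hvd0) hΔ0, WithZero.log_pow] at h12X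
  have hordZ : W.ordMinimalDiscriminant vZ = W.ordMinimalDiscriminant v₂ := ordMinimalDiscriminant_placeTwo_int_eq W
  -- Kraus: `ord₂ Δ_min(W) < 16`
  have hlt16 : W.ordMinimalDiscriminant v₂ < 16 := by
    by_contra hge
    push Not at hge
    obtain ⟨C, hC⟩ := WeierstrassCurve.hasGlobalMinimalModel_rat_holds W
    haveI := hC
    have hmin : (C • W).IsMinimalAt v₂ := IsGloballyMinimal.isMinimal v₂
    have hordC : (C • W).ordMinimalDiscriminant v₂ = W.ordMinimalDiscriminant v₂ := ordMinimalDiscriminant_smul_holds v₂ W C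
    have hΔ : v₂.valuation ℚ (C • W).Δ = exp (-((W.ordMinimalDiscriminant v₂ : ℕ) : ℤ)) := by
      rw [valuation_Δ_eq_of_isMinimalAt_holds v₂ (C • W) hmin, hordC]
    have hΔC0 : v₂.valuation ℚ (C • W).Δ ≠ 0 := by rw [hΔ]; exact exp_ne_zero
    have hΔint : (2 : ℤ) ^ 16 ∣ minimalDiscriminantInt (C • W) := by
      rw [← valuation_intCast_le_exp_iff_two_pow_dvd hv, cast_minimalDiscriminantInt, hΔ, exp_le_exp]
      omega
    have hjC : v₂.valuation ℚ (C • W).j ≤ exp (-12 : ℤ) := by rw [W.variableChange_j C]; exact hj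
    have hc₄ : v₂.valuation ℚ (C • W).c₄ ≤ exp (-8 : ℤ) := by
      refine le_exp_of_pow_three_le_exp ?_
      rw [valuation_j_eq_valuation_c₄_pow_div, div_le_iff₀ (zero_lt_iff.mpr hΔC0), hΔ] at hjC
      refine hjC.trans ?_
      rw [← exp_add, exp_le_exp]
      omega
    have hc₄int : (2 : ℤ) ^ 8 ∣ (integralModelInt (C • W)).c₄ := by
      rw [← valuation_intCast_le_exp_iff_two_pow_dvd hv]
      have e : ((integralModelInt (C • W)).c₄ : ℚ) = (C • W).c₄ := by
        conv_rhs => rw [← map_integralModelInt (C • W)]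
        rw [map_c₄, eq_intCast]
      rw [e]
      exact_mod_cast hc₄
    exact not_pow_dvd_c₄_minimalDiscriminantInt_two (C • W) ⟨hc₄int, hΔint⟩
  refine ⟨hj, fun h ↦ ?_, fun h ↦ ?_⟩
  · rw [hvd, if_pos h, WithZero.log_one, smul_zero, zero_add] at h12X
    rw [hordZ] at hW0 ⊢
    omega
  · have hne : d ≠ -1 := by omega
    rw [hvd, if_neg hne, WithZero.log_exp] at h12X
    simp only [nsmul_eq_mul, Nat.cast_ofNat] at h12X
    rw [hordZ]
    omega

/-- **THE E-BLIND C2 DICTIONARY (all levels `4 ∣ N`).**  For `W/ℚ` additive at `2`: SOME dyadic twist `W ⊗ d`, `d ∈ {−1, 2, −2}`, is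
`2`-semistable ⟺ `ord₂ j ≤ 0` (potentially multiplicative / potentially good ordinary: p2 g14's dyadic untwist) ∨ (`ord₂ j ≥ 12` ∧
`ord₂ Δ_min ∈ {6, 12}`) (the twists by `χ_{±2}, χ_{±6}` resp. `χ₋₁, χ₃` of the good SUPERSINGULAR curves; THEOREMS A, A′, B).  With Barrios
Thm. 5.1 read backwards this refines the cell's core binder: at `v₂(N) = 4` the covered rows are `I₄*/12`, `Iₙ≥5*`, `II*/12`; at `v₂(N) = 6`
they are `I₈*/18`, `Iₙ≥9*`, and — NEW — the part `ord₂ j ≥ 12` of the Kodaira row `II/6` (census N ≤ 5·10⁵: 7 042 of 29 657 classes).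
HONEST FRAMING: local structure by name; nothing about BSD, Manin's conjecture or C2 is proved; C2 OPEN on the core.
[cite: BarriosEtAl2025, Thm. 5.1] [cite: Kraus1989, Prop. 2] [cite: SilvermanAEC2009, VII.5 Prop. 5.1, X.5 Cor. 5.4] -/
theorem exists_conductorExponent_dyadicTwist_le_one_iff_valuation_j (W : WeierstrassCurve ℚ) [W.IsElliptic]
    (h2 : 2 ≤ W.conductorExponent ((primesEquiv (R := ℤ)).symm ⟨2, Nat.prime_two⟩)) :
    (∃ d : ℤ, (d = -1 ∨ d = 2 ∨ d = -2) ∧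
        (W.quadraticTwist (d : ℚ)).conductorExponent ((primesEquiv (R := ℤ)).symm ⟨2, Nat.prime_two⟩) ≤ 1) ↔
      (1 ≤ ((primesEquiv (R := 𝓞 ℚ)).symm ⟨2, Nat.prime_two⟩).valuation ℚ W.j ∨
        (((primesEquiv (R := 𝓞 ℚ)).symm ⟨2, Nat.prime_two⟩).valuation ℚ W.j ≤ exp (-12 : ℤ) ∧
          (W.ordMinimalDiscriminant ((primesEquiv (R := ℤ)).symm ⟨2, Nat.prime_two⟩) = 6 ∨
            W.ordMinimalDiscriminant ((primesEquiv (R := ℤ)).symm ⟨2, Nat.prime_two⟩) = 12))) := by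
  have hv₂ : natGenerator ((primesEquiv (R := 𝓞 ℚ)).symm ⟨2, Nat.prime_two⟩) = 2 :=
    congrArg Subtype.val ((primesEquiv (R := 𝓞 ℚ)).apply_symm_apply ⟨2, Nat.prime_two⟩)
  haveI : PerfectField (IsLocalRing.ResidueField
      (((primesEquiv (R := ℤ)).symm ⟨2, Nat.prime_two⟩).adicCompletionIntegers ℚ)) := PerfectField.ofFinite
  constructor
  · rintro ⟨d, hd, hle⟩
    rcases valuation_j_ordMinimalDiscriminant_of_conductorExponent_dyadicTwist_le_one W hd hle with h | ⟨hj, h12, h6⟩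
    · exact Or.inl h
    · refine Or.inr ⟨hj, ?_⟩
      rcases hd with h | h
      · exact Or.inr (h12 h)
      · exact Or.inl (h6 h)
  · rintro (hj | ⟨hj, h6 | h12⟩)
    · have haddZ : W.HasAdditiveReductionAt ((primesEquiv (R := ℤ)).symm ⟨2, Nat.prime_two⟩) :=
        (two_le_conductorExponent_iff_holds _ W).mp h2
      have hadd : W.HasAdditiveReductionAt ((primesEquiv (R := 𝓞 ℚ)).symm ⟨2, Nat.prime_two⟩) :=
        (W.hasAdditiveReductionAt_int_iff_ringOfIntegers ⟨2, Nat.prime_two⟩).mp haddZ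
      rcases hj.eq_or_lt with h | h
      · exact exists_conductorExponent_dyadicTwist_le_one_of_valuation_j_eq_exp_of_hasAdditiveReductionAt hv₂ W
          (W.valuation_j_eq_exp_zero_of_eq_one _ h.symm) hadd
      · obtain ⟨ν, -, hν⟩ := W.exists_valuation_j_eq_exp _ h
        exact exists_conductorExponent_dyadicTwist_le_one_of_valuation_j_eq_exp_of_hasAdditiveReductionAt hv₂ W hν hadd
    · obtain ⟨d, hd, h0⟩ := exists_conductorExponent_dyadicTwist_eq_zero_of_valuation_j_le_of_ordMinimalDiscriminant_eq_six W hj h6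
      exact ⟨d, Or.inr hd, h0.le.trans zero_le_one⟩
    · exact ⟨-1, Or.inl rfl,
        (conductorExponent_quadraticTwist_negOne_eq_zero_of_valuation_j_le_of_ordMinimalDiscriminant_eq_twelve W hj h12).le.trans
          zero_le_one⟩

/-- **THE C2 CORE, EXPLICITLY.**  For `W/ℚ` additive at `2`, the core binder of `maninOddAtFour_of_core` — EVERY dyadic twist additive at `2` —
holds iff `0 < ord₂ j(W) < 12`, or `ord₂ j(W) ≥ 12` with `ord₂ Δ_min(W) ∉ {6, 12}` (complement of the dictionary).  So the open C2 laws
live exactly on: `v₂(N) ∈ {2, 3, 5, 7, 8}` (all classes), `v₂(N) = 4` rows `II/4, I₀*/8, I₂*/10, I₃*/11`, `v₂(N) = 6` rows `I₀*/10,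
I₂*/12, I₄…₇*/14…17, II*/14` and `II/6 ∩ {ord₂ j ∈ {6, 9}}`.  [cite: BarriosEtAl2025, Thm. 5.1] [cite: Kraus1989, Prop. 2]
[cite: SilvermanAEC2009, VII.5 Prop. 5.1, X.5 Cor. 5.4] -/
theorem forall_two_le_conductorExponent_dyadicTwist_iff_valuation_j (W : WeierstrassCurve ℚ) [W.IsElliptic]
    (h2 : 2 ≤ W.conductorExponent ((primesEquiv (R := ℤ)).symm ⟨2, Nat.prime_two⟩)) :
    (∀ d : ℤ, d = -1 ∨ d = 2 ∨ d = -2 →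
        2 ≤ (W.quadraticTwist (d : ℚ)).conductorExponent ((primesEquiv (R := ℤ)).symm ⟨2, Nat.prime_two⟩)) ↔
      (((primesEquiv (R := 𝓞 ℚ)).symm ⟨2, Nat.prime_two⟩).valuation ℚ W.j < 1 ∧
        (exp (-12 : ℤ) < ((primesEquiv (R := 𝓞 ℚ)).symm ⟨2, Nat.prime_two⟩).valuation ℚ W.j ∨
          (W.ordMinimalDiscriminant ((primesEquiv (R := ℤ)).symm ⟨2, Nat.prime_two⟩) ≠ 6 ∧
            W.ordMinimalDiscriminant ((primesEquiv (R := ℤ)).symm ⟨2, Nat.prime_two⟩) ≠ 12))) := by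
  have key := exists_conductorExponent_dyadicTwist_le_one_iff_valuation_j W h2
  constructor
  · intro h
    have hne : ¬ ∃ d : ℤ, (d = -1 ∨ d = 2 ∨ d = -2) ∧
        (W.quadraticTwist (d : ℚ)).conductorExponent ((primesEquiv (R := ℤ)).symm ⟨2, Nat.prime_two⟩) ≤ 1 := by
      rintro ⟨d, hd, hle⟩; have := h d hd; omega
    rw [key] at hne
    push Not at hne
    refine ⟨hne.1, ?_⟩
    rcases lt_or_ge (exp (-12 : ℤ)) (((primesEquiv (R := 𝓞 ℚ)).symm ⟨2, Nat.prime_two⟩).valuation ℚ W.j) with h' | h'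
    · exact Or.inl h'
    · exact Or.inr (hne.2 h')
  · rintro ⟨hj, h⟩ d hd
    by_contra hlt
    have hex : ∃ d : ℤ, (d = -1 ∨ d = 2 ∨ d = -2) ∧
        (W.quadraticTwist (d : ℚ)).conductorExponent ((primesEquiv (R := ℤ)).symm ⟨2, Nat.prime_two⟩) ≤ 1 := ⟨d, hd, by omega⟩
    rcases key.mp hex with h' | ⟨hj', hord⟩
    · exact absurd hj (not_lt.mpr h')
    · rcases h with h | ⟨h6, h12⟩
      · exact absurd hj' (not_le.mpr h)
      · rcases hord with h | h
        · exact h6 h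
        · exact h12 h

end Summit.BirchSwinnertonDyer.BirchSwinnertonDyer.Theorems.ManinLocalTwoThree

end
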